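import Mathlib.Data.Finset.Sum
import Mathlib.Data.Fintype.Sum
import Summits.CriticalPhenomena.PercolationContinuityZ3.Theorems.PercNearOneGluingNoHeavyLowerTailSahiCombFiveUpSetTriW

/-!
# The five-up-set inequality: TRANSPORT along order isomorphisms, the product cube `2^β × 2^γ`, and the thin-edge
# triangle functional `TRI_W ≥ 0` on the product cube from the ONE-cube inequality

Support file of the one-cut programme (crux `NoHeavyLowerTail`, stmt-CriticalPhenomena-4575; cell `prim-masterthm`, seat P5 gen 8;
report `P5-LORENTZIAN-TEST.md` §11.3, §12.8, §13).

The gen-6 conjecture `FiveUpSet.FiveUpSetIneq` lives on ONE cube `Finset α` with the antipode `compl`; the thin-edge cells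
`(1,b,c)` of the triangle class of (M⁺⁺-3) need it on the PRODUCT cube `W = Finset β × Finset γ` (`= 2^{E₁₃} × 2^{E₂₃}`) with the
antipode `(s,t) ↦ (sᶜ,tᶜ)`, where the members are cylinders (report §11.1–11.3; tree `LatticeFiveUpSet.triWOne`).  The two are the same
statement transported along the order isomorphism `Finset β × Finset γ ≃o Finset (β ⊕ γ)` (Mathlib `Finset.sumEquiv`), which
intertwines the two antipodes.  This file proves exactly that bookkeeping, so that ANY proof of the one-cube inequality — prim-lf-1
gen 17 has announced one via the rank form (RANK-Z), memo `FROM-prim-lf-1-g17-FIVE-UPSET-PROOF.md`, being formalised by that seat —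
yields `TRI_W ≥ 0` on every thin-edge cell geometry with no further work:

* `LatticeFiveUpSet.FiveUpSetIneqOn L τ` — the five-up-set inequality on a given carrier `L` with a given bijection `τ`
  (so `FiveUpSetIneqLattice` = "for every finite distributive lattice and order-reversing `τ`", `fiveUpSetIneqOn_of_lattice`);
* **`LatticeFiveUpSet.fiveUpSetIneqOn_of_orderIso`** — transport: if `e : L ≃o L'` satisfies `e ∘ τ = τ' ∘ e` then the inequality
  on `(L', τ')` gives it on `(L, τ)`;
* `LatticeFiveUpSet.fiveUpSetIneqOn_finset` — `FiveUpSetIneq` is the inequality on `(Finset α, compl)`;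
* `LatticeFiveUpSet.prodCompl`, `toLeft_compl`, `toRight_compl`, **`fiveUpSetIneqOn_prod`** — `FiveUpSetIneq` gives the inequality on
  `(Finset β × Finset γ, (compl, compl))`;
* **`LatticeFiveUpSet.triWOne_nonneg_of_on`** — `TRI_W ≥ 0` at a thin edge on `(W, τ)` from the inequality on `(W, τ)` alone
  (the decomposition `triWOne_eq` + two Kleitman gaps `card_inter_image_le`), and **`triWOne_nonneg_prod`**:
  `FiveUpSetIneq → 0 ≤ triWOne prodCompl P F₀ F₁ G₀ G₁` for up-sets `P, F₀ ⊆ F₁, G₀ ⊆ G₁` of `Finset β × Finset γ`.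
HONEST LABEL: transport bookkeeping and a conditional theorem (hypothesis = the one-cube five-up-set inequality, an obligation of
ours whose proof is announced but not yet in the tree); the class-T bridge from `triWOne` to the tree's (M⁺⁺-3) coefficient
`SahiHybrid.hybCoeff` is a separate file. [this work]
-/

namespace Summit.CriticalPhenomena.PercolationContinuityZ3.Theorems

namespace LatticeFiveUpSet

open Finset

/-! ### The inequality on a given carrier -/

/-- **The five-up-set inequality on the carrier `L` with the bijection `τ`**: for up-sets `P, A₀ ⊆ A₁, B₀ ⊆ B₁` (finite families
of points of `L`), `#(P ∩ A₁ ∩ τB₀) + #(P ∩ τA₀ ∩ B₁) + #(P ∩ τ(A₁ \ A₀) ∩ τ(B₁ \ B₀)) ≤ #(P ∩ A₁ ∩ B₁) + #(P ∩ A₀ ∩ B₀)`.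
(`FiveUpSetIneqLattice` is this for every finite distributive lattice and every order-reversing `τ`.) [this work] -/
def FiveUpSetIneqOn (L : Type*) [Preorder L] [DecidableEq L] (τ : L ≃ L) : Prop :=
  ∀ (P A₀ A₁ B₀ B₁ : Finset L),
    IsUpperSet (P : Set L) → IsUpperSet (A₀ : Set L) → IsUpperSet (A₁ : Set L) →
    IsUpperSet (B₀ : Set L) → IsUpperSet (B₁ : Set L) → A₀ ⊆ A₁ → B₀ ⊆ B₁ →
      (P ∩ A₁ ∩ B₀.image τ).card + (P ∩ A₀.image τ ∩ B₁).card + (P ∩ (A₁ \ A₀).image τ ∩ (B₁ \ B₀).image τ).card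
        ≤ (P ∩ A₁ ∩ B₁).card + (P ∩ A₀ ∩ B₀).card

/-- The lattice conjecture is the inequality on every finite distributive lattice with every order-reversing bijection. [this work] -/
theorem fiveUpSetIneqOn_of_lattice (h : FiveUpSetIneqLattice) (L : Type) [DistribLattice L] [Fintype L] [DecidableEq L]
    (τ : L ≃ L) (hτ : ∀ a b : L, τ a ≤ τ b ↔ b ≤ a) : FiveUpSetIneqOn L τ :=
  fun P A₀ A₁ B₀ B₁ hP hA₀ hA₁ hB₀ hB₁ hA hB => h L τ hτ P A₀ A₁ B₀ B₁ hP hA₀ hA₁ hB₀ hB₁ hA hB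

/-! ### Transport along an order isomorphism intertwining the bijections -/

section Transport

variable {L L' : Type*} [Preorder L] [Preorder L'] [DecidableEq L] [DecidableEq L']

omit [DecidableEq L] in
/-- The image of an up-set under an order isomorphism is an up-set. [folklore] -/
theorem isUpperSet_image_orderIso (e : L ≃o L') {X : Finset L} (hX : IsUpperSet (X : Set L)) :
    IsUpperSet ((X.image e : Finset L') : Set L') := by
  intro a b hab ha
  rw [mem_coe, mem_image] at ha ⊢
  obtain ⟨x, hx, rfl⟩ := ha
  refine ⟨e.symm b, ?_, by simp⟩
  have : x ≤ e.symm b := by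
    have h := e.symm.monotone hab
    simpa using h
  exact hX this hx

/-- **Transport.**  If `e : L ≃o L'` intertwines `τ` and `τ'` (`e (τ x) = τ' (e x)`), the five-up-set inequality on `(L', τ')` implies
it on `(L, τ)`: push the five families forward along `e`; images of up-sets are up-sets, `e` is injective so every count is preserved,
and `e ∘ τ = τ' ∘ e` turns `τ`-images into `τ'`-images. [this work] -/
theorem fiveUpSetIneqOn_of_orderIso (e : L ≃o L') (τ : L ≃ L) (τ' : L' ≃ L') (hτ : ∀ x, e (τ x) = τ' (e x))
    (h : FiveUpSetIneqOn L' τ') : FiveUpSetIneqOn L τ := by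
  intro P A₀ A₁ B₀ B₁ hP hA₀ hA₁ hB₀ hB₁ hA hB
  have hinj : Function.Injective e := e.injective
  have key := h (P.image e) (A₀.image e) (A₁.image e) (B₀.image e) (B₁.image e)
    (isUpperSet_image_orderIso e hP) (isUpperSet_image_orderIso e hA₀) (isUpperSet_image_orderIso e hA₁)
    (isUpperSet_image_orderIso e hB₀) (isUpperSet_image_orderIso e hB₁)
    (image_subset_image hA) (image_subset_image hB)
  -- `τ'`-images of `e`-images are `e`-images of `τ`-images
  have himg : ∀ X : Finset L, (X.image e).image τ' = (X.image τ).image e := by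
    intro X
    rw [image_image, image_image]
    refine image_congr fun x _ => ?_
    simp only [Function.comp_apply]
    exact (hτ x).symm
  rw [← image_sdiff A₁ A₀ hinj, ← image_sdiff B₁ B₀ hinj, himg, himg, himg, himg] at key
  simp only [← image_inter _ _ hinj, card_image_of_injective _ hinj] at key
  exact key

end Transport

/-! ### The one cube: `FiveUpSetIneq` is the inequality on `(Finset α, compl)` -/

section Cube

variable (α : Type*) [DecidableEq α] [Fintype α]

/-- Complementation of the cube `Finset α` as a bijection. [folklore] -/
def complEquiv : Finset α ≃ Finset α := ⟨compl, compl, compl_compl, compl_compl⟩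

/-- `complEquiv s = sᶜ`. [folklore] -/
@[simp] theorem complEquiv_apply (s : Finset α) : complEquiv α s = sᶜ := rfl

/-- Complementation reverses the order. [folklore] -/
theorem complEquiv_le_iff (a b : Finset α) : complEquiv α a ≤ complEquiv α b ↔ b ≤ a :=
  Finset.compl_subset_compl

variable {α}

/-- The antipodal image `FiveUpSet.refl 𝒜` is the image under `complEquiv`. [this work] -/
theorem refl_eq_image (𝒜 : Finset (Finset α)) : FiveUpSet.refl 𝒜 = 𝒜.image (complEquiv α) := by
  ext s
  rw [FiveUpSet.mem_refl, mem_image]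
  constructor
  · intro hs; exact ⟨sᶜ, hs, compl_compl s⟩
  · rintro ⟨t, ht, rfl⟩; simpa using ht

/-- **The one-cube conjecture is the inequality on `(Finset α, compl)`.** [this work] -/
theorem fiveUpSetIneqOn_finset (h : FiveUpSet.FiveUpSetIneq) (α : Type) [DecidableEq α] [Fintype α] :
    FiveUpSetIneqOn (Finset α) (complEquiv α) := by
  intro P A₀ A₁ B₀ B₁ hP hA₀ hA₁ hB₀ hB₁ hA hB
  have key := h α P A₀ A₁ B₀ B₁ hP hA₀ hA₁ hB₀ hB₁ hA hB
  simp only [refl_eq_image] at key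
  exact key

end Cube

/-! ### The product cube `Finset β × Finset γ` with the antipode `(compl, compl)` -/

section Prod

variable (β γ : Type*) [DecidableEq β] [Fintype β] [DecidableEq γ] [Fintype γ]

/-- The antipode of the product cube: `(s, t) ↦ (sᶜ, tᶜ)`. [this work] -/
def prodCompl : (Finset β × Finset γ) ≃ (Finset β × Finset γ) := Equiv.prodCongr (complEquiv β) (complEquiv γ)

/-- `prodCompl (s,t) = (sᶜ, tᶜ)`. [this work] -/
@[simp] theorem prodCompl_apply (w : Finset β × Finset γ) : prodCompl β γ w = (w.1ᶜ, w.2ᶜ) := rfl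

/-- The product antipode reverses the (product) order. [this work] -/
theorem prodCompl_le_iff (a b : Finset β × Finset γ) : prodCompl β γ a ≤ prodCompl β γ b ↔ b ≤ a := by
  simp only [prodCompl_apply, Prod.le_def, Finset.compl_subset_compl]

variable {β γ}

/-- `toLeft` commutes with complementation. [folklore] -/
theorem toLeft_compl (u : Finset (β ⊕ γ)) : uᶜ.toLeft = u.toLeftᶜ := by
  ext x; simp only [mem_toLeft, mem_compl]

/-- `toRight` commutes with complementation. [folklore] -/
theorem toRight_compl (u : Finset (β ⊕ γ)) : uᶜ.toRight = u.toRightᶜ := by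
  ext x; simp only [mem_toRight, mem_compl]

/-- `Finset.sumEquiv` intertwines complementation of `Finset (β ⊕ γ)` with the product antipode. [this work] -/
theorem sumEquiv_compl (u : Finset (β ⊕ γ)) : Finset.sumEquiv uᶜ = prodCompl β γ (Finset.sumEquiv u) := by
  rw [prodCompl_apply]
  ext <;> simp [Finset.sumEquiv, toLeft_compl, toRight_compl]

/-- **The five-up-set inequality on the product cube** `(Finset β × Finset γ, (compl, compl))` from the one-cube conjecture:
transport along `Finset β × Finset γ ≃o Finset (β ⊕ γ)`. [this work] -/
theorem fiveUpSetIneqOn_prod (h : FiveUpSet.FiveUpSetIneq) (β γ : Type) [DecidableEq β] [Fintype β] [DecidableEq γ] [Fintype γ] :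
    FiveUpSetIneqOn (Finset β × Finset γ) (prodCompl β γ) := by
  refine fiveUpSetIneqOn_of_orderIso (Finset.sumEquiv (α := β) (β := γ)).symm (prodCompl β γ) (complEquiv (β ⊕ γ)) ?_
    (fiveUpSetIneqOn_finset h (β ⊕ γ))
  intro x
  rw [complEquiv_apply, OrderIso.symm_apply_eq, sumEquiv_compl, OrderIso.apply_symm_apply]

end Prod

/-! ### `TRI_W ≥ 0` at a thin edge from the inequality on the carrier alone -/

/-- **`TRI_W ≥ 0` at a thin edge** on a finite distributive lattice `W` with an order-reversing bijection `τ`, from the five-up-set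
inequality ON `(W, τ)`: `triWOne_eq` writes `TRI_W` as the five-up-set slack + a shell count + two Kleitman gaps
(`card_inter_image_le` on the up-sets `P ∩ G₀`, `P ∩ F₀`). [this work] -/
theorem triWOne_nonneg_of_on (W : Type) [DistribLattice W] [Fintype W] [DecidableEq W]
    (τ : W ≃ W) (hτ : ∀ a b : W, τ a ≤ τ b ↔ b ≤ a) (h5 : FiveUpSetIneqOn W τ) (P F₀ F₁ G₀ G₁ : Finset W)
    (hP : IsUpperSet (P : Set W)) (hF₀ : IsUpperSet (F₀ : Set W)) (hF₁ : IsUpperSet (F₁ : Set W))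
    (hG₀ : IsUpperSet (G₀ : Set W)) (hG₁ : IsUpperSet (G₁ : Set W)) (hF : F₀ ⊆ F₁) (hG : G₀ ⊆ G₁) :
    0 ≤ triWOne τ P F₀ F₁ G₀ G₁ := by
  rw [triWOne_eq τ P F₀ F₁ G₀ G₁ hF hG]
  have hs := h5 P F₀ F₁ G₀ G₁ hP hF₀ hF₁ hG₀ hG₁ hF hG
  have hPG₀ : IsUpperSet ((P ∩ G₀ : Finset W) : Set W) := by rw [coe_inter]; exact hP.inter hG₀
  have hPF₀ : IsUpperSet ((P ∩ F₀ : Finset W) : Set W) := by rw [coe_inter]; exact hP.inter hF₀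
  have k1 := card_inter_image_le τ hτ (P ∩ G₀) F₁ hPG₀ hF₁
  have k2 := card_inter_image_le τ hτ (P ∩ F₀) G₁ hPF₀ hG₁
  have e1 : P ∩ G₀ ∩ F₁.image τ = P ∩ F₁.image τ ∩ G₀ := by
    rw [inter_assoc, inter_comm G₀, ← inter_assoc]
  have e2 : P ∩ G₀ ∩ F₁ = P ∩ F₁ ∩ G₀ := by
    rw [inter_assoc, inter_comm G₀, ← inter_assoc]
  rw [e1, e2] at k1
  omega

/-- **`TRI_W ≥ 0` at a thin edge on the product cube `2^β × 2^γ`** (the geometry of the thin-edge cells `(1,b,c)` of the triangle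
class, report §11.1–11.3), CONDITIONALLY on the ONE-cube five-up-set inequality `FiveUpSet.FiveUpSetIneq`: for up-sets
`P, F₀ ⊆ F₁, G₀ ⊆ G₁` of `Finset β × Finset γ`, `0 ≤ triWOne prodCompl P F₀ F₁ G₀ G₁`. [this work] -/
theorem triWOne_nonneg_prod (h : FiveUpSet.FiveUpSetIneq) (β γ : Type) [DecidableEq β] [Fintype β] [DecidableEq γ] [Fintype γ]
    (P F₀ F₁ G₀ G₁ : Finset (Finset β × Finset γ))
    (hP : IsUpperSet (P : Set (Finset β × Finset γ))) (hF₀ : IsUpperSet (F₀ : Set (Finset β × Finset γ)))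
    (hF₁ : IsUpperSet (F₁ : Set (Finset β × Finset γ))) (hG₀ : IsUpperSet (G₀ : Set (Finset β × Finset γ)))
    (hG₁ : IsUpperSet (G₁ : Set (Finset β × Finset γ))) (hF : F₀ ⊆ F₁) (hG : G₀ ⊆ G₁) :
    0 ≤ triWOne (prodCompl β γ) P F₀ F₁ G₀ G₁ :=
  triWOne_nonneg_of_on (Finset β × Finset γ) (prodCompl β γ) (prodCompl_le_iff β γ) (fiveUpSetIneqOn_prod h β γ)
    P F₀ F₁ G₀ G₁ hP hF₀ hF₁ hG₀ hG₁ hF hG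

end LatticeFiveUpSet

end Summit.CriticalPhenomena.PercolationContinuityZ3.Theorems
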